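import Summits.AtomisticToContinuum.BoseEinsteinCondensation.Theorems.BECCutLineWeakDisorderLandscapeBoundSiblingR3Defs
import Summits.AtomisticToContinuum.BoseEinsteinCondensation.Theorems.BECCutLineWeakDisorderLandscapeBoundSiblingTelescope
import HarnessLib

/-!
# Route `BECCutLineWeakDisorder`, crux `LandscapeBound` (stmt-AtomisticToContinuum-9087),
# line `sibling-telescoping-chaining`, route R3: the smoothing–block inequality
# (registered bookkeeping stub `stub_smoothingBlock`)

Support file (`--supports stmt-AtomisticToContinuum-9087`; proves the registered bookkeeping stub
`stub_smoothingBlock : Goal.stub_smoothingBlock`, statement `SmoothingBlock` of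
`Theorems/BECCutLineWeakDisorderLandscapeBoundSiblingR3Defs.lean`). Deterministic part (B) of the
stub-worker's route R3 (wave 2): for `g ≤ P_s F` (`P_s` = free heat semigroup at time `s`,
kernel `UVFlatnessR3.heat s`) with `g, F ≥ 0` vanishing off `Λ_L`, and the level-`K` dyadic blocks
`Q` of side `ℓ = L2^{-K}`:
`(∫ g²)² ≤ (∫ g · P_sF)² ≤ R(s,ℓ)² · Σ_Q (∫_Q g)² · Σ_Q (∫_Q F)²` (`sq_lintegral_sq_le`), whence
`r̄_K(g)² ≤ (ℓ³)² R² · Σ_Q(∫_Q F)² / Σ_Q(∫_Q g)²` (`uvParticipation_sq_le`) — a discrete Schur test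
(`schur_sq_le`) for the Gaussian kernel maximised over pairs of blocks (`heat_le_kerBound`), with
geometric row sums (`sum_pow_dist_le`, `sum_kerBound_le`).
-/

noncomputable section

open MeasureTheory ProbabilityTheory Filter Set Finset
open scoped ENNReal NNReal Topology BigOperators

namespace Summit.AtomisticToContinuum.BoseEinsteinCondensation.Cruxes.LandscapeBound.SiblingTelescopingChaining

open Literature.MathematicalPhysics.QuantumManyBody.BoseGas

namespace UVFlatnessR3

/-! #### (B) The deterministic smoothing–block inequality

For `g ≤ P_s F` (`P_s` = free heat semigroup at time `s`) with `g, F ≥ 0` vanishing off `Λ_L`, and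
the level-`K` dyadic blocks `Q` of side `ℓ = L2^{-K}`:
`(∫ g²)² ≤ (∫ g · P_sF)² ≤ R(s,ℓ)² · Σ_Q (∫_Q g)² · Σ_Q (∫_Q F)²`, whence
`r̄_K(g)² ≤ ℓ⁶ R² · Σ_Q(∫_Q F)² / Σ_Q(∫_Q g)²` — a discrete Schur test for the Gaussian kernel
maximised over pairs of blocks (`heat_le_kerBound`, geometric row sums `sum_kerBound_le`). -/

/-- **Discrete Schur test (squared form).** For a kernel `K ≥ 0` on a finite index set whose row
and column sums are at most `M`: `(Σ_i Σ_{i'} K(i,i') a_i b_{i'})² ≤ M² (Σ a²)(Σ b²)`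
(Cauchy–Schwarz on `ι × ι` with `K a b = (K^{1/2}a)(K^{1/2}b)`). -/
theorem schur_sq_le {ι : Type*} [Fintype ι] (Kf : ι → ι → ℝ≥0∞) (a b : ι → ℝ≥0∞) (M : ℝ≥0∞)
    (hrow : ∀ i, ∑ i', Kf i i' ≤ M) (hcol : ∀ i', ∑ i, Kf i i' ≤ M) :
    (∑ i, ∑ i', Kf i i' * (a i * b i')) ^ 2 ≤ M ^ 2 * ((∑ i, a i ^ 2) * ∑ i', b i' ^ 2) := by
  classical
  -- `(x^{1/2})² = x` in `[0, ∞]` (kept local: the tree has `ENNReal.rpow_half_sq` in an unrelated module)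
  have rpow_half_sq : ∀ x : ℝ≥0∞, (x ^ (1 / 2 : ℝ)) ^ 2 = x := fun x => by
    rw [← ENNReal.rpow_natCast, ← ENNReal.rpow_mul]
    norm_num
  set f : ι × ι → ℝ≥0∞ := fun p => Kf p.1 p.2 ^ (1 / 2 : ℝ) * a p.1 with hf
  set g : ι × ι → ℝ≥0∞ := fun p => Kf p.1 p.2 ^ (1 / 2 : ℝ) * b p.2 with hg
  have hfg : ∀ p, f p * g p = Kf p.1 p.2 * (a p.1 * b p.2) := by
    intro p
    simp only [hf, hg]
    calc Kf p.1 p.2 ^ (1 / 2 : ℝ) * a p.1 * (Kf p.1 p.2 ^ (1 / 2 : ℝ) * b p.2)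
        = (Kf p.1 p.2 ^ (1 / 2 : ℝ)) ^ 2 * (a p.1 * b p.2) := by ring
      _ = _ := by rw [rpow_half_sq]
  have hsum : ∑ i, ∑ i', Kf i i' * (a i * b i') = ∑ p : ι × ι, f p * g p := by
    rw [Fintype.sum_prod_type]
    simp only [hfg]
  have hCS := ENNReal.inner_le_Lp_mul_Lq (Finset.univ : Finset (ι × ι)) f g
    Real.HolderConjugate.two_two
  have hf2 : ∑ p : ι × ι, f p ^ (2 : ℝ) ≤ M * ∑ i, a i ^ 2 := by
    calc ∑ p : ι × ι, f p ^ (2 : ℝ) = ∑ i, ∑ i', Kf i i' * a i ^ 2 := by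
          rw [Fintype.sum_prod_type]
          refine Finset.sum_congr rfl fun i _ => Finset.sum_congr rfl fun i' _ => ?_
          simp only [hf, ENNReal.rpow_two, mul_pow, rpow_half_sq]
      _ = ∑ i, a i ^ 2 * ∑ i', Kf i i' := by
          refine Finset.sum_congr rfl fun i _ => ?_
          rw [Finset.mul_sum]
          refine Finset.sum_congr rfl fun i' _ => ?_
          ring
      _ ≤ ∑ i, a i ^ 2 * M := Finset.sum_le_sum fun i _ => mul_le_mul' le_rfl (hrow i)
      _ = M * ∑ i, a i ^ 2 := by rw [← Finset.sum_mul, mul_comm]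
  have hg2 : ∑ p : ι × ι, g p ^ (2 : ℝ) ≤ M * ∑ i', b i' ^ 2 := by
    calc ∑ p : ι × ι, g p ^ (2 : ℝ) = ∑ i, ∑ i', Kf i i' * b i' ^ 2 := by
          rw [Fintype.sum_prod_type]
          refine Finset.sum_congr rfl fun i _ => Finset.sum_congr rfl fun i' _ => ?_
          simp only [hg, ENNReal.rpow_two, mul_pow, rpow_half_sq]
      _ = ∑ i', b i' ^ 2 * ∑ i, Kf i i' := by
          rw [Finset.sum_comm]
          refine Finset.sum_congr rfl fun i' _ => ?_
          rw [Finset.mul_sum]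
          refine Finset.sum_congr rfl fun i _ => ?_
          ring
      _ ≤ ∑ i', b i' ^ 2 * M := Finset.sum_le_sum fun i' _ => mul_le_mul' le_rfl (hcol i')
      _ = M * ∑ i', b i' ^ 2 := by rw [← Finset.sum_mul, mul_comm]
  rw [hsum]
  calc (∑ p : ι × ι, f p * g p) ^ 2
      ≤ ((∑ p : ι × ι, f p ^ (2 : ℝ)) ^ (1 / (2 : ℝ)) *
          (∑ p : ι × ι, g p ^ (2 : ℝ)) ^ (1 / (2 : ℝ))) ^ 2 := pow_le_pow_left' hCS 2
    _ = (∑ p : ι × ι, f p ^ (2 : ℝ)) * (∑ p : ι × ι, g p ^ (2 : ℝ)) := by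
        rw [mul_pow, rpow_half_sq, rpow_half_sq]
    _ ≤ (M * ∑ i, a i ^ 2) * (M * ∑ i', b i' ^ 2) := mul_le_mul' hf2 hg2
    _ = M ^ 2 * ((∑ i, a i ^ 2) * ∑ i', b i' ^ 2) := by ring

/-- **Geometric lattice sums**: `Σ_{j < N} r^{|a - j|} ≤ 2 (1 - r)⁻¹` in `[0, ∞]` (split `j ≤ a`,
`j > a`; each part injects into `Σ_m r^m = (1 - r)⁻¹`). -/
theorem sum_pow_dist_le (N a : ℕ) (r : ℝ≥0∞) :
    ∑ j : Fin N, r ^ Nat.dist a j ≤ 2 * (1 - r)⁻¹ := by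
  classical
  rw [← ENNReal.tsum_geometric, two_mul]
  set A : Finset (Fin N) := Finset.univ.filter (fun j : Fin N => (j : ℕ) ≤ a) with hA
  set B : Finset (Fin N) := Finset.univ.filter (fun j : Fin N => ¬ (j : ℕ) ≤ a) with hB
  have h1 : ∑ j ∈ A, r ^ Nat.dist a j ≤ ∑' m : ℕ, r ^ m := by
    have hinj : Set.InjOn (fun j : Fin N => a - (j : ℕ)) ↑A := by
      intro j hj j' hj' h
      simp only [hA, Finset.coe_filter, Finset.mem_univ, true_and, Set.mem_setOf_eq] at hj hj'
      exact Fin.ext (by dsimp at h; omega)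
    calc ∑ j ∈ A, r ^ Nat.dist a j = ∑ j ∈ A, r ^ (a - (j : ℕ)) := by
          refine Finset.sum_congr rfl fun j hj => ?_
          rw [Nat.dist_eq_sub_of_le_right (Finset.mem_filter.1 hj).2]
      _ = ∑ m ∈ A.image (fun j : Fin N => a - (j : ℕ)), r ^ m := (Finset.sum_image hinj).symm
      _ ≤ ∑' m : ℕ, r ^ m := ENNReal.sum_le_tsum _
  have h2 : ∑ j ∈ B, r ^ Nat.dist a j ≤ ∑' m : ℕ, r ^ m := by
    have hinj : Set.InjOn (fun j : Fin N => (j : ℕ) - a) ↑B := by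
      intro j hj j' hj' h
      simp only [hB, Finset.coe_filter, Finset.mem_univ, true_and, Set.mem_setOf_eq] at hj hj'
      exact Fin.ext (by dsimp at h; omega)
    calc ∑ j ∈ B, r ^ Nat.dist a j = ∑ j ∈ B, r ^ ((j : ℕ) - a) := by
          refine Finset.sum_congr rfl fun j hj => ?_
          rw [Nat.dist_eq_sub_of_le (le_of_not_ge (Finset.mem_filter.1 hj).2)]
      _ = ∑ m ∈ B.image (fun j : Fin N => (j : ℕ) - a), r ^ m := (Finset.sum_image hinj).symm
      _ ≤ ∑' m : ℕ, r ^ m := ENNReal.sum_le_tsum _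
  calc ∑ j : Fin N, r ^ Nat.dist a j
      = (∑ j ∈ A, r ^ Nat.dist a j) + ∑ j ∈ B, r ^ Nat.dist a j :=
        (Finset.sum_filter_add_sum_filter_not _ _ _).symm
    _ ≤ _ := add_le_add h1 h2

/-- **Row sums of the block kernel**: `Σ_{i'} kerBound s ℓ i i' ≤ R(s, ℓ)` (the sum over the
product index set factorises over the three coordinates; each factor is a geometric lattice sum). -/
theorem sum_kerBound_le (s : ℝ≥0) (ℓ : ℝ) {K : ℕ} (i : Fin 3 → Fin (2 ^ K)) :
    ∑ i', kerBound s ℓ i i' ≤ rowBound s ℓ := by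
  classical
  have hprod := Fintype.prod_sum
    (fun (d : Fin 3) (j : Fin (2 ^ K)) => ENNReal.ofReal (kerConst s ℓ * kerRatio s ℓ ^ Nat.dist (i d) j))
  unfold kerBound
  rw [← hprod]
  unfold rowBound
  have h3 : (ENNReal.ofReal (kerConst s ℓ) * (2 * (1 - ENNReal.ofReal (kerRatio s ℓ))⁻¹)) ^ 3 =
      ∏ _d : Fin 3, ENNReal.ofReal (kerConst s ℓ) * (2 * (1 - ENNReal.ofReal (kerRatio s ℓ))⁻¹) := by
    rw [Finset.prod_const, Finset.card_univ, Fintype.card_fin]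
  rw [h3]
  refine Finset.prod_le_prod' fun d _ => ?_
  have hq : 0 ≤ kerRatio s ℓ := (kerRatio_pos s ℓ).le
  calc ∑ j : Fin (2 ^ K), ENNReal.ofReal (kerConst s ℓ * kerRatio s ℓ ^ Nat.dist (i d) j)
      = ∑ j : Fin (2 ^ K), ENNReal.ofReal (kerConst s ℓ) *
          ENNReal.ofReal (kerRatio s ℓ) ^ Nat.dist (i d) j := by
        refine Finset.sum_congr rfl fun j _ => ?_
        rw [ENNReal.ofReal_mul (by unfold kerConst; positivity), ENNReal.ofReal_pow hq]
    _ = ENNReal.ofReal (kerConst s ℓ) * ∑ j : Fin (2 ^ K), ENNReal.ofReal (kerRatio s ℓ) ^ Nat.dist (i d) j := by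
        rw [Finset.mul_sum]
    _ ≤ ENNReal.ofReal (kerConst s ℓ) * (2 * (1 - ENNReal.ofReal (kerRatio s ℓ))⁻¹) :=
        mul_le_mul' le_rfl (sum_pow_dist_le _ _ _)

/-- Column sums of the block kernel (by symmetry). -/
theorem sum_kerBound_le' (s : ℝ≥0) (ℓ : ℝ) {K : ℕ} (i' : Fin 3 → Fin (2 ^ K)) :
    ∑ i, kerBound s ℓ i i' ≤ rowBound s ℓ := by
  simp_rw [kerBound_comm s ℓ _ i']
  exact sum_kerBound_le s ℓ i'

/-- **One-dimensional block separation.** Points of the `a`-th and `b`-th intervals of length `ℓ`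
are at squared distance `≥ ℓ² (|a - b| - 1)`. -/
theorem sq_sub_ge_of_mem_Ico {ℓ : ℝ} {a b : ℕ} {u w : ℝ}
    (hu : u ∈ Set.Ico (ℓ * a) (ℓ * (a + 1))) (hw : w ∈ Set.Ico (ℓ * b) (ℓ * (b + 1))) :
    ℓ ^ 2 * ((Nat.dist a b : ℝ) - 1) ≤ (w - u) ^ 2 := by
  have hℓ : 0 < ℓ := by
    have := hu.1.trans_lt hu.2
    nlinarith
  rcases Nat.eq_zero_or_pos (Nat.dist a b) with h0 | hpos
  · simp only [h0, Nat.cast_zero]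
    nlinarith [sq_nonneg (w - u), sq_nonneg ℓ]
  -- `m = |a - b| ≥ 1`; write `m = k + 1`
  obtain ⟨k, hk⟩ : ∃ k : ℕ, Nat.dist a b = k + 1 := ⟨Nat.dist a b - 1, by omega⟩
  have hk2 : (k : ℝ) ≤ (k : ℝ) ^ 2 := by
    have : k ≤ k ^ 2 := Nat.le_self_pow two_ne_zero k
    exact_mod_cast this
  have hcast : ((Nat.dist a b : ℕ) : ℝ) - 1 = k := by
    rw [hk]; push_cast; ring
  rw [hcast]
  rcases le_total a b with hab | hab
  · -- `b = a + k + 1`, `w - u ≥ ℓ k`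
    have hb : (b : ℝ) = a + k + 1 := by
      have : b = a + (k + 1) := by
        have := Nat.dist_eq_sub_of_le hab; omega
      rw [this]; push_cast; ring
    have h1 : ℓ * k ≤ w - u := by
      have hw1 := hw.1; have hu2 := hu.2
      rw [hb] at hw1
      nlinarith
    have h0k : 0 ≤ ℓ * k := by positivity
    calc ℓ ^ 2 * (k : ℝ) ≤ ℓ ^ 2 * (k : ℝ) ^ 2 := by nlinarith [sq_nonneg ℓ]
      _ = (ℓ * k) ^ 2 := by ring
      _ ≤ (w - u) ^ 2 := pow_le_pow_left₀ h0k h1 2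
  · -- `a = b + k + 1`, `u - w ≥ ℓ k`
    have ha : (a : ℝ) = b + k + 1 := by
      have : a = b + (k + 1) := by
        have := Nat.dist_eq_sub_of_le_right hab; omega
      rw [this]; push_cast; ring
    have h1 : ℓ * k ≤ u - w := by
      have hu1 := hu.1; have hw2 := hw.2
      rw [ha] at hu1
      nlinarith
    have h0k : 0 ≤ ℓ * k := by positivity
    calc ℓ ^ 2 * (k : ℝ) ≤ ℓ ^ 2 * (k : ℝ) ^ 2 := by nlinarith [sq_nonneg ℓ]
      _ = (ℓ * k) ^ 2 := by ring
      _ ≤ (u - w) ^ 2 := pow_le_pow_left₀ h0k h1 2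
      _ = (w - u) ^ 2 := by ring

/-- Membership in a dyadic block, coordinatewise, with `ℓ = L/2^j`. -/
theorem mem_Ico_of_mem_dyadicCube {L : ℝ} {j : ℕ} {i : Fin 3 → Fin (2 ^ j)} {x : Space}
    (hx : x ∈ dyadicCube L j i) (d : Fin 3) :
    x d ∈ Set.Ico (L / 2 ^ j * (i d : ℕ)) (L / 2 ^ j * ((i d : ℕ) + 1)) := by
  have h := hx d
  simp only [Set.mem_Ico] at h ⊢
  constructor
  · calc L / 2 ^ j * (i d : ℕ) = L * (i d : ℕ) / 2 ^ j := by ring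
      _ ≤ x d := h.1
  · calc x d < L * ((i d : ℕ) + 1) / 2 ^ j := h.2
      _ = L / 2 ^ j * ((i d : ℕ) + 1) := by ring

/-- The per-coordinate Gaussian factor between two blocks is bounded by `A q^{|a-b|}`. -/
theorem exp_le_kerConst_mul {ℓ : ℝ} {a b : ℕ} {u w : ℝ}
    (hu : u ∈ Set.Ico (ℓ * a) (ℓ * (a + 1))) (hw : w ∈ Set.Ico (ℓ * b) (ℓ * (b + 1)))
    {s : ℝ≥0} (hs : s ≠ 0) :
    (Real.sqrt (2 * Real.pi * (2 * s)))⁻¹ * Real.exp (-(w - u) ^ 2 / (2 * (2 * s))) ≤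
      kerConst s ℓ * kerRatio s ℓ ^ Nat.dist a b := by
  have hs' : (0 : ℝ) < s := by exact_mod_cast pos_iff_ne_zero.2 hs
  have hsep := sq_sub_ge_of_mem_Ico hu hw
  have key : Real.exp (-(w - u) ^ 2 / (2 * (2 * (s : ℝ)))) ≤
      Real.exp (ℓ ^ 2 / (4 * s)) * Real.exp (-(ℓ ^ 2 / (4 * s))) ^ Nat.dist a b := by
    rw [← Real.exp_nat_mul, ← Real.exp_add]
    refine Real.exp_le_exp.2 ?_
    rw [show (2 : ℝ) * (2 * s) = 4 * s by ring]
    have h4 : (0 : ℝ) < 4 * s := by positivity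
    rw [div_le_iff₀ h4]
    have : (ℓ ^ 2 / (4 * s) + (Nat.dist a b : ℝ) * -(ℓ ^ 2 / (4 * s))) * (4 * s) =
        -(ℓ ^ 2 * ((Nat.dist a b : ℝ) - 1)) := by
      field_simp
      ring
    rw [this]
    linarith
  unfold kerConst kerRatio
  calc (Real.sqrt (2 * Real.pi * (2 * s)))⁻¹ * Real.exp (-(w - u) ^ 2 / (2 * (2 * s)))
      ≤ (Real.sqrt (2 * Real.pi * (2 * s)))⁻¹ *
          (Real.exp (ℓ ^ 2 / (4 * s)) * Real.exp (-(ℓ ^ 2 / (4 * s))) ^ Nat.dist a b) :=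
        mul_le_mul_of_nonneg_left key (inv_nonneg.2 (Real.sqrt_nonneg _))
    _ = _ := by ring

/-- **The heat kernel between two blocks is bounded by the block kernel.** -/
theorem heat_le_kerBound {L : ℝ} (K : ℕ) {s : ℝ≥0} (hs : s ≠ 0) {i i' : Fin 3 → Fin (2 ^ K)}
    {x z : Space} (hx : x ∈ dyadicCube L K i) (hz : z ∈ dyadicCube L K i') :
    heat s x z ≤ kerBound s (L / 2 ^ K) i i' := by
  unfold heat kerBound
  refine Finset.prod_le_prod' fun d _ => ?_
  rw [gaussianPDF, gaussianPDFReal]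
  refine ENNReal.ofReal_le_ofReal ?_
  have h := exp_le_kerConst_mul (mem_Ico_of_mem_dyadicCube hx d) (mem_Ico_of_mem_dyadicCube hz d) hs
  push_cast
  exact h

/-- **(B, bilinear form) The smoothing–block inequality.** For measurable `g, F ≥ 0` vanishing off
`Λ_L` (`L > 0`) and `s > 0`:
`∫ g · (P_s F) ≤ Σ_Q Σ_{Q'} kerBound(Q, Q') (∫_Q g)(∫_{Q'} F)` over the level-`K` dyadic blocks. -/
theorem lintegral_mul_heat_le_sum {L : ℝ} (hL : 0 < L) (K : ℕ) {s : ℝ≥0} (hs : s ≠ 0)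
    {g F : Space → ℝ≥0∞} (hg : Measurable g) (hF : Measurable F)
    (hg0 : ∀ x, x ∉ box L → g x = 0) (hF0 : ∀ z, z ∉ box L → F z = 0) :
    ∫⁻ x, g x * ∫⁻ z, heat s x z * F z ≤
      ∑ i, ∑ i', kerBound s (L / 2 ^ K) i i' * (blockMass g L K i * blockMass F L K i') := by
  -- the smoothed function on a block
  have hPF : ∀ i, ∀ x ∈ dyadicCube L K i,
      ∫⁻ z, heat s x z * F z ≤ ∑ i', kerBound s (L / 2 ^ K) i i' * blockMass F L K i' := by
    intro i x hx
    have h1 : ∫⁻ z, heat s x z * F z ≤ ∑ i', blockMass (fun z => heat s x z * F z) L K i' :=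
      lintegral_le_sum_blockMass hL (fun z hz => by simp [hF0 z hz]) K
    refine h1.trans (Finset.sum_le_sum fun i' _ => ?_)
    unfold blockMass
    calc ∫⁻ z in dyadicCube L K i', heat s x z * F z
        ≤ ∫⁻ z in dyadicCube L K i', kerBound s (L / 2 ^ K) i i' * F z :=
          setLIntegral_mono' (measurableSet_dyadicCube L K i') fun z hz =>
            mul_le_mul' (heat_le_kerBound K hs hx hz) le_rfl
      _ = kerBound s (L / 2 ^ K) i i' * ∫⁻ z in dyadicCube L K i', F z :=
          lintegral_const_mul _ hF
  -- sum over the blocks of `x`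
  have h2 : ∫⁻ x, g x * ∫⁻ z, heat s x z * F z ≤
      ∑ i, blockMass (fun x => g x * ∫⁻ z, heat s x z * F z) L K i :=
    lintegral_le_sum_blockMass hL (fun x hx => by simp [hg0 x hx]) K
  refine h2.trans (Finset.sum_le_sum fun i _ => ?_)
  unfold blockMass
  calc ∫⁻ x in dyadicCube L K i, g x * ∫⁻ z, heat s x z * F z
      ≤ ∫⁻ x in dyadicCube L K i, g x * ∑ i', kerBound s (L / 2 ^ K) i i' * blockMass F L K i' :=
        setLIntegral_mono' (measurableSet_dyadicCube L K i) fun x hx =>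
          mul_le_mul' le_rfl (hPF i x hx)
    _ = (∫⁻ x in dyadicCube L K i, g x) * ∑ i', kerBound s (L / 2 ^ K) i i' * blockMass F L K i' :=
        lintegral_mul_const _ hg
    _ = ∑ i', kerBound s (L / 2 ^ K) i i' * (blockMass g L K i * blockMass F L K i') := by
        rw [Finset.mul_sum]
        refine Finset.sum_congr rfl fun i' _ => ?_
        unfold blockMass
        ring

/-- **(B) The smoothing–block inequality.** If moreover `g ≤ P_s F` pointwise (`P_s` the free
one-line heat semigroup), then `(∫ g²)² ≤ (∫ g · P_sF)² ≤ R(s, ℓ)² · S_K(g) · S_K(F)` with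
`S_K = levelSq · L K` the sums of squared block masses and `R(s,ℓ) = rowBound s ℓ`, `ℓ = L2^{-K}`
(discrete Schur test `schur_sq_le` with the row sums `sum_kerBound_le`). -/
theorem sq_lintegral_sq_le {L : ℝ} (hL : 0 < L) (K : ℕ) {s : ℝ≥0} (hs : s ≠ 0)
    {g F : Space → ℝ≥0∞} (hg : Measurable g) (hF : Measurable F)
    (hg0 : ∀ x, x ∉ box L → g x = 0) (hF0 : ∀ z, z ∉ box L → F z = 0)
    (hdom : ∀ x, g x ≤ ∫⁻ z, heat s x z * F z) :
    (∫⁻ x, g x ^ 2) ^ 2 ≤ rowBound s (L / 2 ^ K) ^ 2 * (levelSq g L K * levelSq F L K) := by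
  have h1 : ∫⁻ x, g x ^ 2 ≤ ∫⁻ x, g x * ∫⁻ z, heat s x z * F z :=
    lintegral_mono fun x => by rw [sq]; exact mul_le_mul' le_rfl (hdom x)
  calc (∫⁻ x, g x ^ 2) ^ 2 ≤ (∫⁻ x, g x * ∫⁻ z, heat s x z * F z) ^ 2 := pow_le_pow_left' h1 2
    _ ≤ (∑ i, ∑ i', kerBound s (L / 2 ^ K) i i' * (blockMass g L K i * blockMass F L K i')) ^ 2 :=
        pow_le_pow_left' (lintegral_mul_heat_le_sum hL K hs hg hF hg0 hF0) 2
    _ ≤ rowBound s (L / 2 ^ K) ^ 2 * (levelSq g L K * levelSq F L K) :=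
        schur_sq_le _ _ _ _ (sum_kerBound_le s _) (sum_kerBound_le' s _)

/-- `[0, ∞]` arithmetic: `m² ≤ X·S ⟹ (m/S)² ≤ X/S` (junk cases `S ∈ {0, ∞}` included). -/
theorem sq_div_le_of_sq_le {m S X : ℝ≥0∞} (h : m ^ 2 ≤ X * S) : (m / S) ^ 2 ≤ X / S := by
  rcases eq_or_ne S 0 with rfl | hS0
  · have hm : m = 0 := by simpa using h
    simp [hm]
  rcases eq_or_ne S ⊤ with rfl | hSt
  · simp [ENNReal.div_top]
  calc (m / S) ^ 2 = m ^ 2 / S ^ 2 := by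
        rw [div_eq_mul_inv, mul_pow, ← ENNReal.inv_pow, ← div_eq_mul_inv]
    _ ≤ X * S / S ^ 2 := ENNReal.div_le_div_right h _
    _ = X / S := by rw [sq, ENNReal.mul_div_mul_right _ _ hS0 hSt]

/-- **(B) for the UV participation**: under `g ≤ P_s F`,
`r̄_K(g)² ≤ ℓ⁶ R(s,ℓ)² · S_K(F) / S_K(g)`. -/
theorem uvParticipation_sq_le {L : ℝ} (hL : 0 < L) (K : ℕ) {s : ℝ≥0} (hs : s ≠ 0)
    {g F : Space → ℝ≥0∞} (hg : Measurable g) (hF : Measurable F)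
    (hg0 : ∀ x, x ∉ box L → g x = 0) (hF0 : ∀ z, z ∉ box L → F z = 0)
    (hdom : ∀ x, g x ≤ ∫⁻ z, heat s x z * F z) :
    uvParticipation g L K ^ 2 ≤
      ENNReal.ofReal ((L / 2 ^ K) ^ 3) ^ 2 * rowBound s (L / 2 ^ K) ^ 2 *
        (levelSq F L K / levelSq g L K) := by
  unfold uvParticipation
  have h := sq_lintegral_sq_le hL K hs hg hF hg0 hF0 hdom
  have h' : (ENNReal.ofReal ((L / 2 ^ K) ^ 3) * ∫⁻ x, g x ^ 2) ^ 2 ≤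
      (ENNReal.ofReal ((L / 2 ^ K) ^ 3) ^ 2 * rowBound s (L / 2 ^ K) ^ 2 * levelSq F L K) *
        levelSq g L K := by
    rw [mul_pow]
    calc ENNReal.ofReal ((L / 2 ^ K) ^ 3) ^ 2 * (∫⁻ x, g x ^ 2) ^ 2
        ≤ ENNReal.ofReal ((L / 2 ^ K) ^ 3) ^ 2 *
            (rowBound s (L / 2 ^ K) ^ 2 * (levelSq g L K * levelSq F L K)) := mul_le_mul' le_rfl h
      _ = _ := by ring
  calc (ENNReal.ofReal ((L / 2 ^ K) ^ 3) * (∫⁻ x, g x ^ 2) / levelSq g L K) ^ 2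
      ≤ (ENNReal.ofReal ((L / 2 ^ K) ^ 3) ^ 2 * rowBound s (L / 2 ^ K) ^ 2 * levelSq F L K) /
          levelSq g L K := sq_div_le_of_sq_le h'
    _ = _ := mul_div_assoc _ _ _

end UVFlatnessR3

/-! ### The registered bookkeeping stub -/

/-- PROVED bookkeeping stub `stub_smoothingBlock` (= `UVFlatnessR3.uvParticipation_sq_le`). -/
theorem stub_smoothingBlock : Goal.stub_smoothingBlock :=
  fun _ hL K _ hs _ _ hg hF hg0 hF0 hdom => UVFlatnessR3.uvParticipation_sq_le hL K hs hg hF hg0 hF0 hdom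

end Summit.AtomisticToContinuum.BoseEinsteinCondensation.Cruxes.LandscapeBound.SiblingTelescopingChaining

end
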